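import Summits.HodgeConjecture.HodgeConjecture.Theses.TropicalKugaSatakeCayley
import Literature.Geometry.Kaehler.ComplexTorusHodge
import Literature.NumberTheory.Transcendental.DeRhamTheorem
import Literature.AlgebraicGeometry.HodgeTheory.ComplexGysin
import Literature.AlgebraicGeometry.HodgeTheory.ComplexOrientationFamily
import Literature.AlgebraicTopology.SingularHomology.CupProduct

/-!
# Line `birth` — KontsevichTransferKS (stmt-HodgeConjecture-18570), route TropicalKugaSatakeCayley

BC3 birth skeleton of the crux `KontsevichTransferKS` (K2 of the refutation route
`TropicalKugaSatakeCayley`): the route's own two-layer plan "K2 ⇐ RankTransfer → Selection → K2",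
typed, with the two risks the route names for K2 — (R1) SPREADING of algebraic cycles of a very general
member `A_z` to the Kuga–Satake cusp, (R2) WEIGHT DROP of the leading graded piece — cut into separate
stubs that meet in ONE concrete dictionary built from tree objects only:

* `tropProj ω I J = ω(f_{Iᶜ}, e_{Jᶜ})` — the `(#f, #e) = (6, 6)` block of a constant complex 12-form on
  `Λ_ℝ = ℝ⁸_x ⊕ ℝ⁸_y` (`inl` = slopes `Γ₂ = ℤ⁸`, `inr` = periods `Γ₁ = τ(z)ℤ⁸`), i.e. the
  `gr^W`-middle (= tropical `(2,2)`) coordinates in the period-coordinate currency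
  `Matrix (Sub 8 2) (Sub 8 2)` of the crux;
* `constFormEquiv Φ φ hφ e : H¹²(X(ℂ); ℂ) ≃ₗ[ℂ] Alt¹²_ℝ(Λ_ℝ; ℂ)` — singular class of the model `X`
  ↦ (homeomorphism `φ`) class on the torus ↦ (de Rham family `e`) de Rham class ↦ (Lange–Birkenhake
  1.1.20, `cconstClassEquiv`) invariant form on `ℂ⁸` ↦ (`Φ`) form on `Λ_ℝ`; a `LinearEquiv`, so no
  injectivity is hidden in a stub;
* `tropClass = tropProj ∘ constFormEquiv`; `flatHodgeForms` = span of the forms of type `(6,6)` at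
  EVERY member of the family (`ComplexTorus.IsConstOfType 6 6` after transport by every KS period
  map) — the Hodge-generic classes; `effectiveClasses p d` = Gysin images `g_* 1_V` of smooth
  projective `d`-folds `g : V ⟶ X` (`complexGysin complexOrientationFamily`), the effective generators.

STUBS (registered obligations, `sorry` only here):
1. `stub_effectiveSpan` (in print, L in the tree): `span_ℂ {g_* 1_V} = algebraicClasses X p`
   (Fulton 19.1.1 + resolution: the coniveau-`p` classes of a smooth projective `X` are spanned by
   cycle classes, and `cl(W) = g_* 1_{W̃}` for a resolution `W̃ → W ⊆ X`).
2. `stub_noWeightDrop` (R2; M; rep theory of the explicit family, machine-checkable): a flat Hodge form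
   with vanishing tropical block is zero (`tropProj` is injective on `flatHodgeForms`: flat Hodge forms
   are invariant under the group generated by all the circles `h_{z'}(U(1))`, which under S5 is
   `Spin(2,5)(ℝ)⁺ ∋` the grading torus of the cusp, so they have `gr^W`-weight `0`).
3. `stub_kontsevichShadow` (R1; XL; THE HEART, not in print): there is a parameter `z` in the tube
   domain, Hodge-generic (every algebraic class of every smooth projective model of `A_z` has flat
   Hodge constant form), at which every finite family of effective surface classes is shadowed, on a
   non-empty open set of cusp parameters `t`, by EFFECTIVE tropical `(2,2)`-cycles of `ℝ⁸/B_t ℤ⁸` whose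
   period classes read out the tropical blocks through ONE injective `ℝ`-linear `Λ` (fixed per model;
   it absorbs the sign/scale conventions of `PD` and of `e`).

`KontsevichTransferKS_of` is the kernel-checked composition (no `sorry`): given `a` `ℂ`-independent
algebraic `(6,6)` classes `α`, STUB 1 + the proved selection lemma `exists_linearIndependent_mem`
replace them by `a` independent EFFECTIVE generators `g`; the Hodge-genericity clause of STUB 3 puts
`constFormEquiv (span g)` inside `flatHodgeForms`, so STUB 2 makes `tropClass` injective on `span g`
(`LinearIndependent.map`); STUB 3 shadows `g` by effective tropical cycles `Z_t` with
`Λ (periodClass (Z_t i)) = tropClass (g i)`, and `LinearIndependent.of_comp Λ` (after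
`restrict_scalars' ℝ`) is the crux's conclusion verbatim.

Why no stub is the crux or the summit reworded: STUB 1 is a statement about ALL smooth projective
varieties with no torus, family or tropical object in it; STUB 2 is finite-dimensional linear algebra
on `Alt¹²(ℝ¹⁶) ⊗ ℂ` with no variety in it; STUB 3 speaks of EFFECTIVE GENERATORS one family at a time
and concludes an EQUATION of classes, not independence — without STUB 2 the read-out may collapse and
without STUB 1 the crux's arbitrary algebraic classes are out of reach. None mentions
`HodgeConjecture`; the crux is an `∃ z`-statement about models of one explicit family.

Disproof used: none on file — `ledger crux ls stmt-HodgeConjecture-18570` had no `Disproof.lean`, no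
ideas and no lines at registration; `ledger negatives --problem HodgeConjecture` has no statement about
Kuga–Satake families, tropical tori or constant forms.
-/

noncomputable section

open CategoryTheory
open Literature.AlgebraicGeometry Literature.AlgebraicGeometry.Tropical
open Literature.AlgebraicGeometry.Tropical.TropicalTorus Literature.AlgebraicGeometry.HodgeTheory
open Literature.NumberTheory.Transcendental Literature.Geometry.Kaehler
open Literature.AlgebraicTopology.SingularHomology

namespace Summit.HodgeConjecture.HodgeConjecture.Cruxes.KontsevichTransferKS.Birth

/-! ### The dictionary: lattice space, tropical block, flat Hodge forms, the comparison -/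

/-- `Λ_ℝ = ℝ⁸_x ⊕ ℝ⁸_y` (`Sum.inl` = `x` = slopes `Γ₂ = ℤ⁸`, `Sum.inr` = `y` = periods `Γ₁`), the
source of the KS period maps `Φ (x, y) = x + τ(z) y`. [folklore] -/
abbrev LatticeSpace : Type := Fin 8 ⊕ Fin 8 → ℝ

/-- Constant complex `12`-forms on `Λ_ℝ`, `Alt¹²_ℝ(Λ_ℝ; ℂ)`. [folklore] -/
abbrev ConstForm : Type := LatticeSpace [⋀^Fin (2 * 6)]→L[ℝ] ℂ

/-- The complementary `6`-subset of a `2`-subset of `Fin 8`. [folklore] -/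
def coSub (I : Sub 8 2) : Sub 8 6 :=
  ⟨Finset.univ \ I.1, by simp [Finset.card_univ_sdiff, I.2]⟩

/-- The `12`-tuple of lattice basis vectors `(f_i)_{i ∉ I} ++ (e_j)_{j ∉ J}` (increasing order;
`f = inr`, `e = inl`). [folklore] -/
def latticeTuple (I J : Sub 8 2) : Fin (2 * 6) → LatticeSpace :=
  Fin.append (m := 6) (n := 6)
    (fun k => Pi.single (Sum.inr ((coSub I).1.orderEmbOfFin (coSub I).2 k)) (1 : ℝ))
    (fun k => Pi.single (Sum.inl ((coSub J).1.orderEmbOfFin (coSub J).2 k)) (1 : ℝ))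

/-- **The tropical block** `tropProj ω I J = ω(f_{Iᶜ}, e_{Jᶜ})`: the coefficients of the monomials
with six `f*`'s and six `e*`'s — the `gr^W`-middle (tropical `(2,2)`) coordinates of a constant
`12`-form, in the period-coordinate currency `Matrix (Sub 8 2) (Sub 8 2)` of the crux.
[cite: MikhalkinZharkov2014Eigenwave, §6.1–6.2] -/
def tropProj : ConstForm →ₗ[ℂ] Matrix (Sub 8 2) (Sub 8 2) ℂ where
  toFun ω := Matrix.of fun I J => ω (latticeTuple I J)
  map_add' _ _ := by ext I J; rfl
  map_smul' _ _ := by ext I J; rfl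

/-- `ω` is a **flat Hodge form**: of type `(6,6)` on EVERY member `A_{z'}` of the Kuga–Satake family
(transported along every KS period map `Φ'` of every `z'` in the tube domain over `ksPosCone`).
[cite: vanGeemenVerra2003QuaternionicPryms, §6.1] -/
def IsFlatHodge (ω : ConstForm) : Prop :=
  ∀ z : Fin 5 → ℂ, (fun i => (z i).im) ∈ ksPosCone →
    ∀ Φ : LatticeSpace ≃L[ℝ] (Fin 8 → ℂ), IsKSPeriodMap z Φ →
      ComplexTorus.IsConstOfType 6 6 (ω.compContinuousLinearMap (Φ.symm : (Fin 8 → ℂ) →L[ℝ] LatticeSpace))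

/-- The `ℂ`-span of the flat Hodge forms (the Hodge-generic `(6,6)` classes of the family).
[cite: vanGeemenVerra2003QuaternionicPryms, Rem. 6.6] -/
def flatHodgeForms : Submodule ℂ ConstForm :=
  Submodule.span ℂ {ω | IsFlatHodge ω}

/-- Pull-back of constant forms along the period isomorphism `Φ : Λ_ℝ ≃ ℂ⁸`. [folklore] -/
def pullForm (Φ : LatticeSpace ≃L[ℝ] (Fin 8 → ℂ)) :
    ((Fin 8 → ℂ) [⋀^Fin (2 * 6)]→L[ℝ] ℂ) ≃ₗ[ℂ] ConstForm where
  toFun c := c.compContinuousLinearMap (Φ : LatticeSpace →L[ℝ] (Fin 8 → ℂ))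
  invFun ω := ω.compContinuousLinearMap (Φ.symm : (Fin 8 → ℂ) →L[ℝ] LatticeSpace)
  map_add' c c' := by ext v; simp
  map_smul' r c := by ext v; simp
  left_inv c := by ext v; simp [Function.comp_def]
  right_inv ω := by ext v; simp [Function.comp_def]

/-- **The comparison** `H¹²(X(ℂ); ℂ) ≃ₗ[ℂ] Alt¹²_ℝ(Λ_ℝ; ℂ)` of a model `X` of the torus
`ComplexTorus Φ` through the uniformisation `φ` (a homeomorphism) and a complex de Rham isomorphism
family `e`: `φ^*`, then `(e _ 12)⁻¹`, then the Lange–Birkenhake average `cconstClassEquiv⁻¹`, then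
`Φ^*`. [cite: LangeBirkenhake1992, Prop. 1.1.20] -/
def constFormEquiv (Φ : LatticeSpace ≃L[ℝ] (Fin 8 → ℂ)) {X : Motives.SchemeOver ℂ}
    (φ : ComplexTorus Φ → Motives.ComplexPoints X) (hφ : IsHomeomorph φ)
    (e : ComplexDeRhamIsoFamily (Fin 8 → ℂ)) : complexBetti X (2 * 6) ≃ₗ[ℂ] ConstForm :=
  (singularCohomology.mapIso (R := ℂ) (M := ℂ) (IsHomeomorph.homeomorph φ hφ) (2 * 6)).toLinearEquiv
    ≪≫ₗ (e (ComplexTorus Φ) (2 * 6)).symm ≪≫ₗ (ComplexTorus.cconstClassEquiv Φ).symm ≪≫ₗ pullForm Φ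

/-- **The tropical class map** of a model: tropical block of the constant form of a class.
[cite: MikhalkinZharkov2014Eigenwave, §7.1] -/
def tropClass (Φ : LatticeSpace ≃L[ℝ] (Fin 8 → ℂ)) {X : Motives.SchemeOver ℂ}
    (φ : ComplexTorus Φ → Motives.ComplexPoints X) (hφ : IsHomeomorph φ)
    (e : ComplexDeRhamIsoFamily (Fin 8 → ℂ)) :
    complexBetti X (2 * 6) →ₗ[ℂ] Matrix (Sub 8 2) (Sub 8 2) ℂ :=
  tropProj ∘ₗ (constFormEquiv Φ φ hφ e).toLinearMap

/-- **Effective generators**: the Gysin images `g_* 1_V ∈ H^{2p}(X(ℂ); ℂ)` of the smooth projective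
`d`-folds over `X`, `d + p = dim X` (the cycle classes `cl(g_* [V])`).
[cite: VoisinHodgeI2002, §11.1.2] [cite: Fulton1998, §19.1] -/
def effectiveClasses {n : ℕ} (p d : ℕ) (hdp : d + p = n) (X : Motives.SchemeOver ℂ)
    (hX : Motives.IsSmoothProjective n X) : Set (complexBetti X (2 * p)) :=
  {c | ∃ (V : Motives.SchemeOver ℂ) (hV : Motives.IsSmoothProjective d V) (g : V ⟶ X),
    c = complexGysin complexOrientationFamily hV hX g (a := 0) (b := 2 * p) (by omega)
      (singularCohomology.one ℂ (Motives.ComplexPoints V))}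

/-! ### Selection (proved): independent vectors in a span come with as many independent generators -/

/-- If `a` linearly independent vectors lie in `span G`, then `G` contains `a` linearly independent
vectors (`|b| = dim span G ≥ a` for an independent spanning `b ⊆ G`). [folklore] -/
theorem exists_linearIndependent_mem {K V : Type} [DivisionRing K] [AddCommGroup V] [Module K V]
    (G : Set V) {a : ℕ} {v : Fin a → V} (hv : LinearIndependent K v)
    (hG : ∀ i, v i ∈ Submodule.span K G) :
    ∃ g : Fin a → V, (∀ i, g i ∈ G) ∧ LinearIndependent K g := by
  classical
  obtain ⟨b, hbG, hbspan, hbli⟩ := exists_linearIndependent K G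
  have hv' : LinearIndependent K (fun i => (⟨v i, by rw [hbspan]; exact hG i⟩ : Submodule.span K b)) :=
    LinearIndependent.of_comp (Submodule.span K b).subtype (by exact hv)
  have hrank : Module.rank K (Submodule.span K b) = Cardinal.mk b :=
    rank_span_set (show LinearIndepOn K id b from hbli)
  have hcard : Cardinal.mk (Fin a) ≤ Cardinal.mk b := by
    have h := hv'.cardinal_le_rank
    rwa [hrank] at h
  obtain ⟨emb⟩ := (Cardinal.le_def (Fin a) b).1 hcard
  exact ⟨fun i => (emb i : V), fun i => hbG (emb i).2, hbli.comp emb emb.injective⟩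

/-! ### The three stubs -/

/-- **STUB 1 — EFFECTIVE SPANNING** (in print; L-sized in the tree). For `X` smooth projective of
dimension `n = d + p`, the space of algebraic classes `Nᵖ H²ᵖ(X(ℂ); ℂ)` is the `ℂ`-span of the Gysin
images `g_* 1_V` of smooth projective `d`-folds `g : V ⟶ X`: `⊇` because `g_* 1_V = cl(g_*[V])` is
supported on the codimension-`p` closed set `g(V)` (or is `0`), `⊆` because coniveau-`p` classes in
degree `2p` are spanned by the cycle classes of the codimension-`p` subvarieties `W` (Fulton 19.1.1 /
Deligne) and `cl(W) = g_* 1_{W̃}` for a resolution `W̃ → W`. Why it might fail: only through a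
mismatch of the tree's `supportedClasses` (kernel-of-restriction coniveau) with the span of cycle
classes in degree `2p` — a purity statement (Deligne, Remark (vi)) the tree has not yet proved for
all `p`. [cite: Fulton1998, §19.1 Lemma 19.1.1] [cite: VoisinHodgeI2002, §11.1.2]
[cite: Deligne2000, §2 Remark (vi)] -/
theorem stub_effectiveSpan :
    ∀ {n : ℕ} (p d : ℕ) (hdp : d + p = n) (X : Motives.SchemeOver ℂ)
      (hX : Motives.IsSmoothProjective n X),
      Submodule.span ℂ (effectiveClasses p d hdp X hX) = algebraicClasses X p := by
  sorry

/-- **STUB 2 — NO WEIGHT DROP** (risk R2 of the route; M-sized; representation theory of the explicit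
family, machine-checkable on `Alt¹²(ℝ¹⁶)`, `dim = 1820`). A flat Hodge form whose tropical `(6,6)`-block
vanishes is zero. Mechanism: the set of flat Hodge forms is stable under the real translations
`u_X : (x,y) ↦ (x + B_X y, y)` and the scalings `(x,y) ↦ (λ^{1/2} x, λ^{-1/2} y)` of the tube domain,
and each flat Hodge form is fixed by the group generated by the circles `h_{z'}(U(1))`, `z' ∈ T`,
which (the family being the `Spin(2,5)` tube domain, route crux S5) is `Spin(2,5)(ℝ)⁺` and contains
the grading torus of the cusp: flat Hodge forms have `gr^W`-weight `0`, i.e. live on the monomials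
with six `e*` and six `f*`, all of whose coefficients `tropProj` reads. Why it might fail: if the
explicit `ksForm` family is NOT the homogeneous type-`IV₅` tube domain (S5 false as typed) the circles
might generate a group missing the grading torus, and a flat form of pure non-zero weight would be a
counterexample (then the route is moot anyway). [cite: vanGeemenVerra2003QuaternionicPryms, §6.1, Rem. 6.6]
[cite: MikhalkinZharkov2014Eigenwave, §6.2] -/
theorem stub_noWeightDrop :
    ∀ ω ∈ flatHodgeForms, tropProj ω = 0 → ω = 0 := by
  sorry

/-- **STUB 3 — THE KONTSEVICH SHADOW WITH FAITHFUL READ-OUT** (risk R1 of the route; XL; the heart,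
NOT in print). There is a parameter `z` of the tube domain such that for every KS period map `Φ` of
`z`, every smooth projective model `X` of `ℂ⁸/Λ_z` and every analytic uniformisation `φ`, there are a
natural complex de Rham family `e` and ONE injective `ℝ`-linear read-out `Λ` (absorbing the sign /
`(2πi)`-scale conventions of Poincaré duality and of `e`) with: (i) HODGE-GENERICITY — the constant
form of every algebraic class of `X` is a flat Hodge form (at a very general `z` algebraic classes are
rational `(6,6)` classes invariant under the generic Mumford–Tate group, hence `(6,6)` on every
member); (ii) SHADOWS — every finite family of effective surface classes `g_* 1_V` is realised, for
all cusp parameters `t` in a non-empty open subset of `ksPosCone`, by EFFECTIVE balanced tropical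
`(2,2)`-cycles `Z_t i` of `ℝ⁸/B_t ℤ⁸` with `Λ (C₂(B_t)⁻¹ • [Z_t i]) = tropClass (g i)` (spreading of
the surfaces over the toroidal boundary of the Kuga–Satake family + Kontsevich–Mikhalkin–Zharkov
tropicalisation: the tropical limit is effective and its class is the `gr^W`-middle piece of the
specialised class). Why it might fail: (R1) surfaces on the very general `A_z` need not extend to a
neighbourhood of the cusp without base change / modification, and the tropical limit of a family of
surfaces acquiring embedded or non-reduced limits may fail to be an effective `(2,2)`-cycle with the
predicted class. [cite: MikhalkinZharkov2014Eigenwave, §7.1] [cite: Zharkov2020TropicalWeil, pp. 2–3]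
[cite: vanGeemenVerra2003QuaternionicPryms, §6.7] -/
theorem stub_kontsevichShadow :
    ∃ z : Fin 5 → ℂ, (fun i => (z i).im) ∈ ksPosCone ∧
      ∀ (Φ : LatticeSpace ≃L[ℝ] (Fin 8 → ℂ)), IsKSPeriodMap z Φ →
        ∀ (X : Motives.SchemeOver ℂ) (hX : Motives.IsSmoothProjective 8 X)
          (φ : ComplexTorus Φ → Motives.ComplexPoints X)
          (hφ : IsAnalytification (Fin 8 → ℂ) X 8 φ),
          ∃ e : ComplexDeRhamIsoFamily (Fin 8 → ℂ), e.IsNatural ∧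
            (∀ c ∈ algebraicClasses X 6,
              constFormEquiv Φ φ hφ.isHomeomorph e c ∈ flatHodgeForms) ∧
            ∃ Λ : Matrix (Sub 8 2) (Sub 8 2) ℝ →ₗ[ℝ] Matrix (Sub 8 2) (Sub 8 2) ℂ,
              Function.Injective Λ ∧
              ∀ (a : ℕ) (g : Fin a → complexBetti X (2 * 6)),
                (∀ i, g i ∈ effectiveClasses 6 2 rfl X hX) →
                  ∃ U : Set (Fin 5 → ℝ), IsOpen U ∧ U.Nonempty ∧ U ⊆ ksPosCone ∧
                    ∀ t ∈ U, ∃ Z : Fin a → Chain ℝ 8 2, ∀ i,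
                      (Z i).IsCycle (ksMatrix t) ∧ (Z i).Effective ∧
                        Λ (compound 2 (ksMatrix t)⁻¹ * (Z i).classOf) =
                          tropClass Φ φ hφ.isHomeomorph e (g i) := by
  sorry

/-! ### Name-keyed aliases of the three statements — the hypotheses of `KontsevichTransferKS_of`
(device of `Cruxes/CuspStep/Lines/birth.lean`: `__Registered.stub_X` is the statement of `stub_X`
verbatim under the stub's short name; `KontsevichTransferKS_of_stubs` checks by `rfl`-unfolding that
each alias IS its stub's statement). -/
namespace __Registered

/-- Statement of `stub_effectiveSpan`, keyed by the registered stub name. -/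
abbrev stub_effectiveSpan : Prop :=
  ∀ {n : ℕ} (p d : ℕ) (hdp : d + p = n) (X : Motives.SchemeOver ℂ)
    (hX : Motives.IsSmoothProjective n X),
    Submodule.span ℂ (effectiveClasses p d hdp X hX) = algebraicClasses X p

/-- Statement of `stub_noWeightDrop`, keyed by the registered stub name. -/
abbrev stub_noWeightDrop : Prop :=
  ∀ ω ∈ flatHodgeForms, tropProj ω = 0 → ω = 0

/-- Statement of `stub_kontsevichShadow`, keyed by the registered stub name. -/
abbrev stub_kontsevichShadow : Prop :=
  ∃ z : Fin 5 → ℂ, (fun i => (z i).im) ∈ ksPosCone ∧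
    ∀ (Φ : LatticeSpace ≃L[ℝ] (Fin 8 → ℂ)), IsKSPeriodMap z Φ →
      ∀ (X : Motives.SchemeOver ℂ) (hX : Motives.IsSmoothProjective 8 X)
        (φ : ComplexTorus Φ → Motives.ComplexPoints X)
        (hφ : IsAnalytification (Fin 8 → ℂ) X 8 φ),
        ∃ e : ComplexDeRhamIsoFamily (Fin 8 → ℂ), e.IsNatural ∧
          (∀ c ∈ algebraicClasses X 6,
            constFormEquiv Φ φ hφ.isHomeomorph e c ∈ flatHodgeForms) ∧
          ∃ Λ : Matrix (Sub 8 2) (Sub 8 2) ℝ →ₗ[ℝ] Matrix (Sub 8 2) (Sub 8 2) ℂ,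
            Function.Injective Λ ∧
            ∀ (a : ℕ) (g : Fin a → complexBetti X (2 * 6)),
              (∀ i, g i ∈ effectiveClasses 6 2 rfl X hX) →
                ∃ U : Set (Fin 5 → ℝ), IsOpen U ∧ U.Nonempty ∧ U ⊆ ksPosCone ∧
                  ∀ t ∈ U, ∃ Z : Fin a → Chain ℝ 8 2, ∀ i,
                    (Z i).IsCycle (ksMatrix t) ∧ (Z i).Effective ∧
                      Λ (compound 2 (ksMatrix t)⁻¹ * (Z i).classOf) =
                        tropClass Φ φ hφ.isHomeomorph e (g i)

end __Registered

/-! ### The composition: effective spanning + selection → shadows → no weight drop → the crux -/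

/-- **THE LINE'S COMPOSITION — THE SKELETON THEOREM** (kernel-checked, no `sorry`): STUBS 1–3 imply
`KontsevichTransferKS` BY NAME. Take the `z` of STUB 3. Given a model `(Φ, X, φ)` and `a`
`ℂ`-independent algebraic `(6,6)` classes `α`: STUB 1 puts them in the span of the effective surface
classes, the selection lemma picks `a` independent effective generators `g`; STUB 3 gives `e`, the
Hodge-genericity of `z`, the read-out `Λ` and, on an open set of cusp parameters, effective tropical
shadows `Z_t` with `Λ (C₂(B_t)⁻¹ [Z_t i]) = tropClass (g i)`; Hodge-genericity + STUB 2 make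
`tropClass` injective on `span g ⊆ algebraicClasses X 6` (`LinearIndependent.map`), so
`tropClass ∘ g` is `ℂ`-, hence `ℝ`-independent, and `LinearIndependent.of_comp Λ` is the conclusion.
[cite: MikhalkinZharkov2014Eigenwave, §7.1] [cite: vanGeemenVerra2003QuaternionicPryms, §6.7] -/
theorem KontsevichTransferKS_of :
    __Registered.stub_effectiveSpan → __Registered.stub_noWeightDrop →
      __Registered.stub_kontsevichShadow →
        Summit.HodgeConjecture.HodgeConjecture.Theses.TropicalKugaSatakeCayley.KontsevichTransferKS := by
  intro hSpan hNWD hShadow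
  obtain ⟨z, hz, hzS⟩ := hShadow
  refine ⟨z, hz, ?_⟩
  intro Φ hΦ X hX φ hφ a α hαli hα
  obtain ⟨e, _he, hgen, Λ, _hΛ, hfam⟩ := hzS Φ hΦ X hX φ hφ
  -- STUB 1: the algebraic classes are spanned by the effective surface classes
  have hspan : Submodule.span ℂ (effectiveClasses 6 2 rfl X hX) = algebraicClasses X 6 :=
    hSpan 6 2 rfl X hX
  have hGalg : effectiveClasses 6 2 rfl X hX ⊆ (algebraicClasses X 6 : Set (complexBetti X (2 * 6))) := by
    rw [← hspan]; exact Submodule.subset_span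
  -- selection: `a` independent effective generators
  obtain ⟨g, hgG, hgli⟩ := exists_linearIndependent_mem (effectiveClasses 6 2 rfl X hX) hαli
    (fun i => by rw [hspan]; exact (hα i).2.2)
  -- STUB 3: shadows of the generators on an open set of cusp parameters
  obtain ⟨U, hUo, hUne, hUs, hU⟩ := hfam a g hgG
  refine ⟨U, hUo, hUne, hUs, fun t ht => ?_⟩
  obtain ⟨Z, hZ⟩ := hU t ht
  refine ⟨Z, fun i => ⟨(hZ i).1, (hZ i).2.1⟩, ?_⟩
  -- Hodge-genericity + STUB 2: `tropClass` is injective on `span g`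
  have hdisj : Disjoint (Submodule.span ℂ (Set.range g))
      (LinearMap.ker (tropClass Φ φ hφ.isHomeomorph e)) := by
    rw [Submodule.disjoint_def]
    intro x hx hker
    have hxalg : x ∈ algebraicClasses X 6 :=
      (Submodule.span_le.2 (Set.range_subset_iff.2 fun i => hGalg (hgG i))) hx
    have hflat := hgen x hxalg
    have hzero : constFormEquiv Φ φ hφ.isHomeomorph e x = 0 :=
      hNWD _ hflat (LinearMap.mem_ker.1 hker)
    exact (LinearEquiv.map_eq_zero_iff _).1 hzero
  have h1 : LinearIndependent ℂ (tropClass Φ φ hφ.isHomeomorph e ∘ g) := hgli.map hdisj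
  have h2 : LinearIndependent ℝ (tropClass Φ φ hφ.isHomeomorph e ∘ g) := h1.restrict_scalars' ℝ
  have h3 : (tropClass Φ φ hφ.isHomeomorph e ∘ g) =
      Λ ∘ fun i => compound 2 (ksMatrix t)⁻¹ * (Z i).classOf :=
    funext fun i => ((hZ i).2.2).symm
  rw [h3] at h2
  exact LinearIndependent.of_comp Λ h2

/-- **The crux, closed modulo exactly the three registered stubs**; sanity: the stubs compose and each
alias is its stub's statement. -/
theorem KontsevichTransferKS_of_stubs :
    Summit.HodgeConjecture.HodgeConjecture.Theses.TropicalKugaSatakeCayley.KontsevichTransferKS :=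
  KontsevichTransferKS_of stub_effectiveSpan stub_noWeightDrop stub_kontsevichShadow

end Summit.HodgeConjecture.HodgeConjecture.Cruxes.KontsevichTransferKS.Birth

end
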